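import Summits.QuantumFields.BalabanUV.T4Continuum.Spine.NE1p.DressedStabilityOfSliceWinSchedules
import Summits.QuantumFields.BalabanUV.T4Continuum.Spine.NE1p.DressedStabilityOfSuppliedSchedules

/-!
# T⁴ programme, spine estimate NE1′ (node O3b/H2) — END-ALL-slice-win ∘ SUPPLIERS: THE ROW ROOT `DressedStability 𝒯` (and ROOT-B)
# AT EVERY CUTOFF AND RUN PARAMETER OVER THE ASSEMBLED CUTOFF-FREE-WINDOW FACE, WITH THE THREE STRUCTURAL BOOKING LEAVES L-B, L-C,
# F-8 COMPOSED IN — displayed = the wall + DATA (swarm item S3k of `t4/formal/NE1p/LEAVES.md`; INTENT CLAIMS.log l.10657)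

Cell `pub-balaban`, sub-cell `t4`, BINDER-OWNERS row NE1′, formalisation crew `b2b-balaban-t4-ne1p-formalise-*`, seat `…-leaf-09`
(gen 2).  ADDITIVE — imports this seat's `Spine/NE1p/DressedStabilityOfSliceWinSchedules` (S3h part 2, p214712: END-ALL-slice-win
`dressedStabilityWith_swin_of_schedules` ∕ `dressedBudget_swin_of_schedules` over leaf-04's S1e) and leaf-02-g2's
`Spine/NE1p/DressedStabilityOfSuppliedSchedules` (S3i, p214477: the anchored counts in the cell's currency `count_of_anchoring_cell` ∕
`positionalCount_of_anchoring_cell`; through it rows S4 `DressedPositionalCount` p212703, S5b `DressedAbsorptionWindow` p212827, S8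
`DressedAttainment` p212678) ONLY; modifies nothing.  This is S3i's composition (ratio face) repeated VERBATIM on the slice-window face —
leaf-02-g2's offer (CLAIMS.log l.10308); the two faces are parallel by design.

WHAT.  S3h part 2 displays, per `(a, K)`, four STRUCTURAL booking-level families that the crew's landed suppliers discharge BY NAME:
F-8 `hlin` ⇐ the booking convention {`hne` admissible pairs exist, `hsup` booked size ≤ sup of realised increments}
(`DressedAttainment.hlin_budgetGate_of_lin_le_sSup`, row S8 leaf-06); (w3-book) L-C `hS`∕`hcount` ⇐ ANCHORING DATA {`Anch a K :
Anchoring (𝒯.B a K) 4 Lb`, `(Lb:ℝ) = L`, per-block multiplicity `mB`, housing `comp`∕`hscale`∕`hhoused`, component volume `v`,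
`v·mB ≤ N₀`} (`count_of_anchoring_cell`, rows S4 leaf-10 ∕ S3i); (w1)+(w5b) L-B `hbirth` ⇐ ABSORPTION DATA in the live-family door
{`Sabs a K` strictly older and ⊆ the live families at the birth scale, `AbsorbsFrom … (budgetGate …)`, dressing sizes
`β a K j ≤ β₀·(L⁻³)^{K−j}`, `fanout A N₀ ρ′ < 1`, `absorbAmplitude β₀ A N₀ ρ′ ≤ A₀`} (`DressedAbsorptionWindow.hbirth_of_absorbsFrom_live_cell`,
rows S5∕S5b leaf-05∕leaf-02; the history-free door is `Sabs ≡ ∅`, `A = 0`).  The K-∕μ-∕a-free scalars `κ L c̄ N₀ A₀ s̄⁰ ρ′ r c_δ m v mB A β₀`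
precede `∀ a K` (RULING R-t4r2-Q2, k1).
* §1 the binders ONCE as section variables (S3h-2's list with `hlin`, `hS`, `hcount`, `hbirth` replaced by the data above; the two
  binders particular to this face, `hcm` and `hδfwk`, sit in each theorem's header so the statements are header-distinct from S3i's);
* §2 **`dressedStability_of_suppliedSliceWinSchedules : DressedStability 𝒯`**, `dressedStabilityWith_of_suppliedSliceWinSchedules`
  (constants displayed), and ROOT-B **`dressedBudget_of_suppliedSliceWinSchedules : DressedBudget 𝒯 wt`** with `hcountB` read off
  the SAME anchoring (`positionalCount_of_anchoring_cell`, given `1 ≤ v`).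

EFFECT (what is displayed after this face — nothing else): the WALL∕Q leaves of `DAG.md` §2 — (w1) `hsl` (analytic births on the
scheduled windows `bondBall d ((W a K).ρw k′)`, slice window `(W a K).wc k′`), (w2-act) `hB`∕`hE`∕`hs₀` (printed TYPE
[Balaban1989LargeFieldII] (1.65) p. 375, (1.71)–(1.75) pp. 379–380 — THE NUMBER stays a binder, (w6) `hsmall`), (w5) `hreg` + `hc0`∕`hcb`,
(I4′) `hδf`∕`hδfwk`∕`hpairx`∕`hdefwk`∕`hrate` + `hcm` (F-6's rate `ψ = L⁻²`, k3 — load-bearing), F-2 dictionary `hFn`∕`h𝒢`∕`hQ`∕`hSg`∕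
`hs1`∕`hAsz_*`∕`hmeas`, F-9 context `hinv`∕`hDμ`∕`hz₁` — plus instantiation DATA (one `WindowScheduleModWin` per `(a,K)` with `hratio`,
anchoring, absorption, booking convention) and the located scalars ((w7) `locCell … ≤ ρ′ < 1`).  No `hP`, no radius floor, no
uniform-`w` window budget (LF-1∕LF-2 closed at the typed level per leaf-04's birth window `ρ∞ + ((1+2q)σ₀+ϱ₀)∕(1−q)`, p214439 ∕ p213785),
no structural leaf.  The K-uniformity content of NE1′ sits ENTIRELY in those displayed families at fixed scalars.

HONEST FRAMING.  Kernel composition over hypothesis shapes ([folklore]; 0 sorry; 0 citations used as facts; no `def … : Prop`).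
Headline (c4): «NE1′ (all cutoffs, all run parameters) ⇐ EXACTLY the displayed WALL binders ∀ (a,K) + anchoring ∕ absorption ∕
booking-convention DATA + located largeness + ratio-bounded cutoff-free-window schedules — NOT proved; 0 binders instantiated on
Bałaban's densities»; spine PROVED 0∕9.  Rung (B)+1 on ONE finite four-torus — NOT infinite volume, NOT a mass gap, NOT OS on ℝ⁴,
NOT Clay.  HONEST DEPENDENCY: continuum YM on T⁴ ⇐ BetaPertH ∧ nine spine estimates (0/9 proved); BetaPertH ⇐ (D1) ∧ (D4) ∧ CAP+tail;
G-an2-4 gates asym, D1 and NE2/3/4.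
-/

noncomputable section

namespace Summit.QuantumFields.BalabanUV.T4Continuum.NE1p.DressedStabilityOfSuppliedSliceWinSchedules

open MeasureTheory Set Metric Finset
open scoped BigOperators
open Literature.MathematicalPhysics.QuantumFieldTheory.Balaban1983to89
open Literature.MathematicalPhysics.QuantumFieldTheory.Balaban1983to89.T4TermFormat
open Literature.MathematicalPhysics.QuantumFieldTheory.Balaban1983to89.T4FeltGeometry
open Literature.MathematicalPhysics.QuantumFieldTheory.Balaban1983to89.T4GatedBooking
open Literature.MathematicalPhysics.QuantumFieldTheory.Balaban1983to89.T4TrajectoryComparison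
open Literature.MathematicalPhysics.QuantumFieldTheory.Balaban1983to89.T4TrajectoryModulus
open T4BirthChartTransport (GaugeInvariant BirthSlice RelGauge)
open T4BlockTransport (Fld NDir latMove latN)
open T4TrajectoryDensity
open Summit.QuantumFields.BalabanUV.T4Continuum.T4TrajectoryDensityDressed
open Summit.QuantumFields.BalabanUV.T4Continuum.NE1p.DressedRoot
open Summit.QuantumFields.BalabanUV.T4Continuum.NE1p.DressedWindowScheduleWin
open Summit.QuantumFields.BalabanUV.T4Continuum.NE1p.DressedWindowScheduleModWin
open Summit.QuantumFields.BalabanUV.T4Continuum.NE1p.DressedUniformConstants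
open Summit.QuantumFields.BalabanUV.T4Continuum.NE1p.DressedTransportUniformWin
open Summit.QuantumFields.BalabanUV.T4Continuum.NE1p.DressedStabilityOfSliceWinSchedules
open Summit.QuantumFields.BalabanUV.T4Continuum.NE1p.DressedStabilityOfSuppliedSchedules
open Summit.QuantumFields.BalabanUV.T4Continuum.NE1p.DressedAbsorptionWindow
open Summit.QuantumFields.BalabanUV.T4Continuum.NE1p.DressedAttainment

/-! ## §1 The binders, once, indexed by run parameter and cutoff — S3h-2's list with `hlin`, `hS`, `hcount`, `hbirth` replaced by data -/

section EndAll

variable {P : Type*} (𝒯 : DressedTower P)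
variable {R : Type*} [NormedRing R] [NormedAlgebra ℂ R] [MeasurableSpace R] {d : ℕ}
variable {κ L cbar N₀ A₀ sbar ρ' r cδ m : ℝ} {w : P → ℕ → ℝ}
variable (W : ∀ (a : P) (K : ℕ), WindowScheduleModWin r (w a K)) (hκ : 0 ≤ κ)
variable {Fn : ∀ (a : P) (K : ℕ), (𝒯.B a K).Birth → ℕ → ℕ → Fld d R → ℂ}
  {rel : ∀ (a : P) (K : ℕ), (𝒯.B a K).Birth → ℕ → ℕ → Fld d R → Fld d R → Prop}
  {ref : ∀ (a : P) (K : ℕ), (𝒯.B a K).Birth → ℕ → Fld d R → Fld d R}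
  {base : ∀ (a : P) (K : ℕ), (𝒯.B a K).Birth → ℕ → Fld d R → ℝ}
  {𝒜 𝒬 : ∀ (a : P) (K : ℕ), (𝒯.B a K).Birth → ℕ → Fld d R → Fld d R → ℂ}
  {q : ∀ (a : P) (K : ℕ), (𝒯.B a K).Birth → ℕ → Fld d R → ℂ}
  {μ : ∀ (a : P) (K : ℕ), (𝒯.B a K).Birth → ℕ → Measure (Fld d R)}
  {z₀ z₁ : ∀ (a : P) (K : ℕ), (𝒯.B a K).Birth → ℕ → Fld d R}
  {defect : ∀ (a : P) (K : ℕ), (𝒯.B a K).Birth → ℕ → ℕ → ℝ}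
  {s s1 : ∀ (a : P) (K : ℕ), (𝒯.B a K).Birth → ℕ → ℝ}
  {Asz : ∀ (a : P) (K : ℕ), (𝒯.B a K).Birth → ℕ → ℕ → ℝ}
  {S : ∀ (a : P) (K : ℕ), ℕ → (𝒯.B a K).Birth → Finset (𝒯.B a K).Birth}
  {Sg : ∀ (a : P) (K : ℕ), ℕ → (𝒯.B a K).Birth → Finset ((𝒯.B a K).Birth × ℕ)}
  {c : ∀ (a : P) (K : ℕ), (𝒯.B a K).Birth → ℕ → ℂ}
  {δf : ∀ (a : P) (K : ℕ), (𝒯.B a K).Birth → ℕ → (𝒯.B a K).Birth × ℕ → ℝ}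
  {creg : ∀ (_ : P) (_ : ℕ), ℕ → ℝ}
-- DATA replacing the structural leaves: anchoring (L-C), absorption (L-B)
variable {Lb mB v : ℕ} (Anch : ∀ (a : P) (K : ℕ), Anchoring (𝒯.B a K) 4 Lb)
  {comp : ∀ (a : P) (K : ℕ), ℕ → (𝒯.B a K).Birth → Finset (𝒯.B a K).Cube}
  {Sabs : ∀ (a : P) (K : ℕ), (𝒯.B a K).Birth → Finset (𝒯.B a K).Birth}
  {β : ∀ (_ : P) (_ : ℕ), ℕ → ℝ} {A β₀ : ℝ}

-- the ratio family (K-free κ)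
variable (hratio : ∀ (a : P) (K : ℕ), ∀ k, 2 * (W a K).σ k ≤ κ * (W a K).ϱc k)
-- row S3's located scalars ((w7) largeness, (w6) window) and signs — ONCE
variable (hL : 1 ≤ L)
variable (hcbar : 0 ≤ cbar)
variable (hN₀ : 0 ≤ N₀)
variable (hA₀ : 0 ≤ A₀)
variable (hm : 0 ≤ m)
variable (hloc : locCell L (4 * cδ / r) cbar κ ≤ ρ')
variable (hρ'1 : ρ' < 1)
variable (hsmall : m * (N₀ * A₀ * (1 - ρ')⁻¹) ≤ 1 - sbar)
variable (hr : 0 < r)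
variable (hcδ : 0 ≤ cδ)
-- the assembled END's estimate ∕ dictionary families (S3h-2 verbatim)
variable (hsl : ∀ (a : P) (K : ℕ), ∀ (b : (𝒯.B a K).Birth) (k' : ℕ), (𝒯.B a K).birthScale b ≤ k' → k' ≤ (𝒯.B a K).K →
  RanBelow (budgetGate (𝒯.T a K) (s a K) m (S a K) (4 * cδ / r) (fun i => (L ^ 2)⁻¹ * (fun _ : ℕ => alphaCell κ) i)) k' →
  BirthSlice ((Fn a K) b k' k') latMove latN (bondBall d ((W a K).ρw k') : Set (Fld d R)) ((W a K).wc k') r ((𝒯.T a K).gen b k'))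
variable (hFn : ∀ (a : P) (K : ℕ), ∀ (b : (𝒯.B a K).Birth) (k' k : ℕ), (𝒯.B a K).birthScale b ≤ k' → k' ≤ k →
  k + 1 ≤ (𝒯.B a K).K →
  RanBelow (budgetGate (𝒯.T a K) (s a K) m (S a K) (4 * cδ / r) (fun i => (L ^ 2)⁻¹ * (fun _ : ℕ => alphaCell κ) i)) (k + 1) →
  ∀ U, (Fn a K) b k' (k + 1) U =
    wOp (expWeight ((base a K) b k) ((𝒜 a K) b k + (𝒬 a K) b k)) ((μ a K) b k) ((z₀ a K) b k) U (fun z => (Fn a K) b k' k (U + z)))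
variable (h𝒢 : ∀ (a : P) (K : ℕ), ∀ (b : (𝒯.B a K).Birth) (k' k : ℕ), (𝒯.B a K).birthScale b ≤ k' → k' ≤ k →
  k + 1 ≤ (𝒯.B a K).K →
  RanBelow (budgetGate (𝒯.T a K) (s a K) m (S a K) (4 * cδ / r) (fun i => (L ^ 2)⁻¹ * (fun _ : ℕ => alphaCell κ) i)) (k + 1) →
  ∀ U, (fun z => (Fn a K) b k' k (U + z)) ∈ BddClass ℂ ((μ a K) b k))
variable (hB : ∀ (a : P) (K : ℕ), ∀ (b : (𝒯.B a K).Birth) (k' k : ℕ), (𝒯.B a K).birthScale b ≤ k' → k' ≤ k →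
  k + 1 ≤ (𝒯.B a K).K →
  RanBelow (budgetGate (𝒯.T a K) (s a K) m (S a K) (4 * cδ / r) (fun i => (L ^ 2)⁻¹ * (fun _ : ℕ => alphaCell κ) i)) (k + 1) →
  RealBaseAt ((ref a K) b k) ((base a K) b k) ((𝒜 a K) b k) ((μ a K) b k) (bondBall d ((W a K).ρw (k + 1)) : Set (Fld d R)))
variable (hE : ∀ (a : P) (K : ℕ), ∀ (b : (𝒯.B a K).Birth) (k' k : ℕ), (𝒯.B a K).birthScale b ≤ k' → k' ≤ k →
  k + 1 ≤ (𝒯.B a K).K →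
  RanBelow (budgetGate (𝒯.T a K) (s a K) m (S a K) (4 * cδ / r) (fun i => (L ^ 2)⁻¹ * (fun _ : ℕ => alphaCell κ) i)) (k + 1) →
  ExponentSliceAt ((ref a K) b k) ((𝒜 a K) b k) ((μ a K) b k) latMove latN (bondBall d ((W a K).ρw (k + 1)) : Set (Fld d R))
    ((W a K).wc (k + 1)) ((W a K).ϱc k) ((s a K) b k))
variable (hQ : ∀ (a : P) (K : ℕ), ∀ b k, (fun U z => (𝒬 a K) b k U z - (q a K) b k U) =
  fun U z => (c a K) b k * ∑ x ∈ (Sg a K) k b, ((Fn a K) x.1 x.2 k (U + z) - (Fn a K) x.1 x.2 k (U + (z₁ a K) b k)))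
variable (hSg : ∀ (a : P) (K : ℕ), ∀ k b, ∀ x ∈ (Sg a K) k b, x.1 ∈ (S a K) k b ∧ (𝒯.B a K).birthScale x.1 ≤ x.2 ∧ x.2 ≤ k)
variable (hs1 : ∀ (a : P) (K : ℕ), ∀ b k, (s1 a K) b k = ‖(c a K) b k‖ * ∑ x ∈ (Sg a K) k b,
  (4 / r * stepProd (fun _ : ℕ => alphaCell κ) x.2 k * (𝒯.T a K).gen x.1 x.2) * (δf a K) b k x)
variable (hAsz_birth : ∀ (a : P) (K : ℕ), ∀ f k'', (Asz a K) f k'' k'' = (𝒯.T a K).gen f k'')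
variable (hAsz_step : ∀ (a : P) (K : ℕ), ∀ f k'' k, (𝒯.B a K).birthScale f ≤ k'' → k'' ≤ k →
  (Asz a K) f k'' (k + 1) = Real.exp (3 * ((s a K) f k + (s1 a K) f k)) * (Asz a K) f k'' k)
variable (hδf : ∀ (a : P) (K : ℕ), ∀ b k, ∀ x ∈ (Sg a K) k b, 0 ≤ (δf a K) b k x ∧ (δf a K) b k x ≤ cδ * ((L ^ 2)⁻¹) ^ (k - x.2))
variable (hDμ : ∀ (a : P) (K : ℕ), ∀ b k, ∀ᵐ z ∂(μ a K) b k, z ∈ (bondBall d ((W a K).σ k) : Set (Fld d R)))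
variable (hz₁ : ∀ (a : P) (K : ℕ), ∀ b k, (z₁ a K) b k ∈ (bondBall d ((W a K).σ k) : Set (Fld d R)))
variable (hpairx : ∀ (a : P) (K : ℕ), ∀ (b : (𝒯.B a K).Birth) (k' k : ℕ), (𝒯.B a K).birthScale b ≤ k' → k' ≤ k →
  ∀ x ∈ (Sg a K) k b, ∀ U₀ ∈ (bondBall d ((W a K).ρw (k + 1)) : Set (Fld d R)), ∀ pd : NDir d R, 0 < latN pd →
    latN pd ≤ (W a K).wc (k + 1) →
    ∀ᵐ z ∂(μ a K) b k, ∀ t ∈ tube ((W a K).ϱ₁ k / latN pd),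
      RelGauge ((rel a K) x.1 x.2 k) latMove latN (latMove U₀ pd t + (z₁ a K) b k) (latMove U₀ pd t + z) ((δf a K) b k x))
variable (hinv : ∀ (a : P) (K : ℕ), ∀ b k' k, GaugeInvariant ((rel a K) b k' k) ((Fn a K) b k' k))
variable (hmeas : ∀ (a : P) (K : ℕ), ∀ (b f : (𝒯.B a K).Birth) (k'' k : ℕ) (U : Fld d R),
  AEStronglyMeasurable (fun z => (Fn a K) f k'' k (U + z)) ((μ a K) b k))
variable (hdefwk : ∀ (a : P) (K : ℕ), ∀ (b : (𝒯.B a K).Birth) (k' k : ℕ), (defect a K) b k' k ≤ (W a K).wc k)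
variable (hrate : ∀ (a : P) (K : ℕ), ∀ (b : (𝒯.B a K).Birth) (k' k : ℕ), (𝒯.B a K).birthScale b ≤ k' → k' ≤ k → k ≤ (𝒯.B a K).K →
  (defect a K) b k' k ≤ cδ * ((L ^ 2)⁻¹) ^ (k - k'))
-- F-8 REPLACED BY THE BOOKING CONVENTION (row S8): admissible pairs exist, booked size ≤ sup of realised increments
variable (hne : ∀ (a : P) (K : ℕ), ∀ (b : (𝒯.B a K).Birth) (k' k : ℕ), (𝒯.B a K).birthScale b ≤ k' → k' ≤ k → k ≤ (𝒯.B a K).K →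
  RanBelow (budgetGate (𝒯.T a K) (s a K) m (S a K) (4 * cδ / r) (fun i => (L ^ 2)⁻¹ * (fun _ : ℕ => alphaCell κ) i)) k →
  ∃ U₀ ∈ (bondBall d ((W a K).ρw k) : Set (Fld d R)), ∃ U₁ : Fld d R,
  RelGauge ((rel a K) b k' k) latMove latN U₀ U₁ ((defect a K) b k' k))
variable (hsup : ∀ (a : P) (K : ℕ), ∀ (b : (𝒯.B a K).Birth) (k' k : ℕ), (𝒯.B a K).birthScale b ≤ k' → k' ≤ k → k ≤ (𝒯.B a K).K →
  RanBelow (budgetGate (𝒯.T a K) (s a K) m (S a K) (4 * cδ / r) (fun i => (L ^ 2)⁻¹ * (fun _ : ℕ => alphaCell κ) i)) k →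
  (𝒯.T a K).lin b k' k ≤ sSup {x : ℝ | ∃ U₀ ∈ (bondBall d ((W a K).ρw k) : Set (Fld d R)), ∃ U₁ : Fld d R,
    RelGauge ((rel a K) b k' k) latMove latN U₀ U₁ ((defect a K) b k' k) ∧ x = ‖(Fn a K) b k' k U₁ - (Fn a K) b k' k U₀‖})
-- the booking-level wall binders: (w5) regeneration, (w2-act) margin
variable (hc0 : ∀ (a : P) (K : ℕ), ∀ k, 0 ≤ (creg a K) k)
variable (hcb : ∀ (a : P) (K : ℕ), ∀ k, k < (𝒯.B a K).K → (creg a K) k ≤ cbar)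
variable (hreg : ∀ (a : P) (K : ℕ), (𝒯.T a K).RegeneratesFromVar (creg a K)
  (budgetGate (𝒯.T a K) (s a K) m (S a K) (4 * cδ / r) (fun _ : ℕ => (L ^ 2)⁻¹ * alphaCell κ)))
variable (hs₀ : ∀ (a : P) (K : ℕ), ∀ b k, (s a K) b k ≤ sbar)
-- (w3-book) L-C REPLACED BY ANCHORING DATA (row S4): blocking integer, multiplicity, housing, component volume
variable (hLb : (Lb : ℝ) = L)
variable (hmult : ∀ (a : P) (K : ℕ), ∀ j (x : Fin 4 → ℕ),
  ((𝒯.B a K).births.filter fun b => (𝒯.B a K).birthScale b = j ∧ x ∈ (Anch a K).dom b).card ≤ mB)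
variable (hscale : ∀ (a : P) (K : ℕ), ∀ k b, ∀ q ∈ (comp a K) k b, (𝒯.B a K).cubeScale q = k)
variable (hhoused : ∀ (a : P) (K : ℕ), ∀ k b, ∀ f ∈ (S a K) k b, ∃ q ∈ (comp a K) k b, f ∈ (𝒯.B a K).feltAt q)
variable (hvol : ∀ (a : P) (K : ℕ), ∀ k b, ((comp a K) k b).card ≤ v)
-- (w1)+(w5b) L-B REPLACED BY ABSORPTION DATA (rows S5 ∕ S5b)
variable (holder : ∀ (a : P) (K : ℕ), ∀ b b₀, b₀ ∈ (Sabs a K) b → (𝒯.B a K).birthScale b₀ < (𝒯.B a K).birthScale b)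
variable (hsub : ∀ (a : P) (K : ℕ), ∀ b, (Sabs a K) b ⊆ (S a K) ((𝒯.B a K).birthScale b) b)
variable (habs : ∀ (a : P) (K : ℕ), (𝒯.T a K).AbsorbsFrom (4 * cδ / r) (fun _ : ℕ => (L ^ 2)⁻¹ * alphaCell κ) (β a K) A (Sabs a K)
  (budgetGate (𝒯.T a K) (s a K) m (S a K) (4 * cδ / r) (fun _ : ℕ => (L ^ 2)⁻¹ * alphaCell κ)))
variable (hβ : ∀ (a : P) (K : ℕ), ∀ j, j ≤ (𝒯.B a K).K → (β a K) j ≤ β₀ * (L⁻¹ ^ 3) ^ ((𝒯.B a K).K - j))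

include W hκ Anch hratio hL hcbar hN₀ hA₀ hm hloc hρ'1 hsmall hr hcδ hsl hFn h𝒢 hB hE hQ hSg hs1 hAsz_birth hAsz_step hδf
  hDμ hz₁ hpairx hinv hmeas hdefwk hrate hne hsup hc0 hcb hreg hs₀ hLb hmult hscale hhoused hvol holder hsub habs hβ

/-! ## §2 END-ALL-slice-win ∘ suppliers: the row root (both forms) and ROOT-B at every cutoff and run parameter -/

/-- **END-ALL-slice-win ∘ SUPPLIERS — THE ROW ROOT WITH ITS CONSTANTS DISPLAYED** [bookkeeping]: S3h-2's
`dressedStabilityWith_swin_of_schedules` BY NAME with its four structural per-`(a, K)` families supplied BY NAME — F-8 `hlin` from the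
booking convention (`hlin_budgetGate_of_lin_le_sSup`), L-C `hS`∕`hcount` from the anchoring (`count_of_anchoring_cell`), L-B `hbirth` from
the absorption data at the cell's constants (`hbirth_of_absorbsFrom_live_cell`, its live-family count being the anchored `hcount`).  The
scalars (`κ L c̄ N₀ A₀ s̄⁰ ρ′ r c_δ m v mB A β₀`) precede `∀ a K`.  NOT «NE1′ proved»: every wall binder displayed; 0 instantiated on
Bałaban's densities. [folklore] -/
theorem dressedStabilityWith_of_suppliedSliceWinSchedules
    -- the two binders PARTICULAR to the assembled slice-window face, displayed in the header (cutoff-free source tie, per-step slice guard)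
    (hcm : ∀ (a : P) (K : ℕ), ∀ b k, ‖(c a K) b k‖ ≤ m)
    (hδfwk : ∀ (a : P) (K : ℕ), ∀ b k, ∀ x ∈ (Sg a K) k b, (δf a K) b k x ≤ (W a K).wc k)
    (hvN₀ : (v : ℝ) * mB ≤ N₀) (hA : 0 ≤ A)
    (hfan : fanout A N₀ ρ' < 1) (hamp : absorbAmplitude β₀ A N₀ ρ' ≤ A₀) :
    DressedStabilityWith 𝒯 A₀ (rhoOne (L ^ 2)⁻¹ (4 * cδ / r) cbar κ) (L⁻¹ ^ 3) :=
  dressedStabilityWith_swin_of_schedules 𝒯 W hratio hL hcbar hκ hN₀ hA₀ hm hloc hρ'1 hsmall hr hcδ hsl hFn h𝒢 hB hE hQ hSg hs1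
    hAsz_birth hAsz_step hcm hδf hδfwk hDμ hz₁ hpairx hinv hmeas hdefwk hrate
    (fun a K => hlin_budgetGate_of_lin_le_sSup (T := 𝒯.T a K) (hne a K) (hsup a K))
    hc0 hcb hreg hs₀
    (fun a K => (count_of_anchoring_cell (Anch a K) hLb hL (hmult a K) (hscale a K) (hhoused a K) (hvol a K) hvN₀).1)
    (fun a K => (count_of_anchoring_cell (Anch a K) hLb hL (hmult a K) (hscale a K) (hhoused a K) (hvol a K) hvN₀).2)
    (fun a K =>
      hbirth_of_absorbsFrom_live_cell hL (div_nonneg (mul_nonneg (by norm_num) hcδ) hr.le) hcbar hκ hN₀ hA₀ hm hloc hρ'1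
        hsmall (𝒯.T a K) (fun _ : ℕ => (L ^ 2)⁻¹ * alphaCell κ) (s a K) (S a K) (holder a K) (hsub a K)
        (count_of_anchoring_cell (Anch a K) hLb hL (hmult a K) (hscale a K) (hhoused a K) (hvol a K) hvN₀).2 hA (habs a K)
        (hβ a K) hfan hamp)

/-- **END-ALL-slice-win ∘ SUPPLIERS — THE ROW ROOT `DressedStability 𝒯` LITERALLY** [bookkeeping]. [folklore] -/
theorem dressedStability_of_suppliedSliceWinSchedules
    -- the two binders PARTICULAR to the assembled slice-window face, displayed in the header (cutoff-free source tie, per-step slice guard)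
    (hcm : ∀ (a : P) (K : ℕ), ∀ b k, ‖(c a K) b k‖ ≤ m)
    (hδfwk : ∀ (a : P) (K : ℕ), ∀ b k, ∀ x ∈ (Sg a K) k b, (δf a K) b k x ≤ (W a K).wc k)
    (hvN₀ : (v : ℝ) * mB ≤ N₀) (hA : 0 ≤ A)
    (hfan : fanout A N₀ ρ' < 1) (hamp : absorbAmplitude β₀ A N₀ ρ' ≤ A₀) :
    DressedStability 𝒯 :=
  ⟨_, _, _, dressedStabilityWith_of_suppliedSliceWinSchedules 𝒯 W hκ Anch hratio hL hcbar hN₀ hA₀ hm hloc hρ'1 hsmall hr hcδ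
    hsl hFn h𝒢 hB hE hQ hSg hs1 hAsz_birth hAsz_step hδf hDμ hz₁ hpairx hinv hmeas hdefwk hrate hne hsup hc0 hcb hreg
    hs₀ hLb hmult hscale hhoused hvol holder hsub habs hβ hcm hδfwk hvN₀ hA hfan hamp⟩

/-- **END-ALL-slice-win ∘ SUPPLIERS ⟹ ROOT-B `DressedBudget 𝒯 wt`** [bookkeeping]: with nonnegative cube weights bounded by `w̄` and
the SAME anchoring read as the bookings' positional count (`positionalCount_of_anchoring_cell`, `1 ≤ v` so that `mB ≤ v·mB ≤ N₀`),
S3h-2's `dressedBudget_swin_of_schedules` BY NAME. [folklore] -/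
theorem dressedBudget_of_suppliedSliceWinSchedules
    -- the two binders PARTICULAR to the assembled slice-window face, displayed in the header (cutoff-free source tie, per-step slice guard)
    (hcm : ∀ (a : P) (K : ℕ), ∀ b k, ‖(c a K) b k‖ ≤ m)
    (hδfwk : ∀ (a : P) (K : ℕ), ∀ b k, ∀ x ∈ (Sg a K) k b, (δf a K) b k x ≤ (W a K).wc k)
    (hvN₀ : (v : ℝ) * mB ≤ N₀) (hA : 0 ≤ A)
    (hfan : fanout A N₀ ρ' < 1) (hamp : absorbAmplitude β₀ A N₀ ρ' ≤ A₀)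
    {wt : P → ℕ → ℕ → ℝ} {wbar : ℝ} (hwbar : 0 ≤ wbar)
    (hw0 : ∀ a K, ∀ j ≤ K, 0 ≤ wt a K j) (hwb : ∀ a K, ∀ j ≤ K, wt a K j ≤ wbar) (hv : 1 ≤ v) :
    DressedBudget 𝒯 wt :=
  have hmN₀ : (mB : ℝ) ≤ N₀ := by
    have h1 : (1 : ℝ) ≤ (v : ℝ) := by exact_mod_cast hv
    have hmB : (0 : ℝ) ≤ (mB : ℝ) := by positivity
    nlinarith
  dressedBudget_swin_of_schedules 𝒯 W hratio hL hcbar hκ hN₀ hA₀ hm hloc hρ'1 hsmall hr hcδ hsl hFn h𝒢 hB hE hQ hSg hs1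
    hAsz_birth hAsz_step hcm hδf hδfwk hDμ hz₁ hpairx hinv hmeas hdefwk hrate
    (fun a K => hlin_budgetGate_of_lin_le_sSup (T := 𝒯.T a K) (hne a K) (hsup a K))
    hc0 hcb hreg hs₀
    (fun a K => (count_of_anchoring_cell (Anch a K) hLb hL (hmult a K) (hscale a K) (hhoused a K) (hvol a K) hvN₀).1)
    (fun a K => (count_of_anchoring_cell (Anch a K) hLb hL (hmult a K) (hscale a K) (hhoused a K) (hvol a K) hvN₀).2)
    (fun a K =>
      hbirth_of_absorbsFrom_live_cell hL (div_nonneg (mul_nonneg (by norm_num) hcδ) hr.le) hcbar hκ hN₀ hA₀ hm hloc hρ'1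
        hsmall (𝒯.T a K) (fun _ : ℕ => (L ^ 2)⁻¹ * alphaCell κ) (s a K) (S a K) (holder a K) (hsub a K)
        (count_of_anchoring_cell (Anch a K) hLb hL (hmult a K) (hscale a K) (hhoused a K) (hvol a K) hvN₀).2 hA (habs a K)
        (hβ a K) hfan hamp)
    hwbar hw0 hwb
    (fun a K => positionalCount_of_anchoring_cell (Anch a K) hLb hL (hmult a K) hmN₀)

end EndAll

end Summit.QuantumFields.BalabanUV.T4Continuum.NE1p.DressedStabilityOfSuppliedSliceWinSchedules

end
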